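import Literature.GroupTheory.CombinatorialGroupTheory.AmalgamConjugationTheorem
import Mathlib.Logic.Relation
import HarnessLib

/-!
# Conjugacy of elliptic elements in an amalgam (MKS Thm. 4.6 (i)(ii); Dyer's Thm. 2 (1)(2))

Topic `Literature/GroupTheory/CombinatorialGroupTheory`; theorems only, continuing
`AmalgamReducedWords` / `AmalgamConjugation` / `AmalgamConjugationTheorem` (letter lists in Mathlib's
`Monoid.PushoutI φ`; reduced = alternating factors, no letter in the amalgamated subgroup; value
`ℓπ[φ] l`).  This file is the **length `≤ 1` half** of the conjugacy criterion for amalgamated free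
products (Magnus–Karrass–Solitar §4.2 Thm. 4.6 (i)(ii); in Dyer's wording, J. Austral. Math. Soc. (A)
29 (1980) Thm. 2 p.37–38: *"Let `x ∈ P` be of minimal length in its conjugacy class. Suppose `y ∈ P`,
`y` is cyclically reduced, and `y ~_P x`. (1) If `‖x‖ = 0`, then `‖y‖ ≤ 1` and if `y ∈ A` say, there
is a sequence `h₁, h₂, …, h_r` of elements in `H` such that `y ~_A h₁ ~_B h₂ ~_A ⋯ ~ h_r = x`.
(2) If `‖x‖ = 1`, then `‖y‖ = 1` and either `x ∈ A`, `y ∈ A` and `x ~_A y`, or else `x ∈ B`, `y ∈ B`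
and `x ~_B y`."*), complementing the length `≥ 2` part (iii) landed as
`Amalgam.exists_rotate_of_isConj` / `isConj_iff_exists_rotate` (`AmalgamConjugacyCriterion.lean`).

The *chain relation through the base group* of MKS (i) is spelled out inline as
`Relation.ReflTransGen (fun c c' : H => ∃ i, IsConj (φ i c) (φ i c')) c c'` ("a finite sequence of
elements of `H`, consecutive terms conjugate in a factor"); no definition is introduced.

* `isConj_base_iff_reflTransGen` — **MKS 4.6 (i) for base elements**: `base c ~ base c'` in the
  amalgam iff `c`, `c'` are joined by such a chain (core induction
  `reflTransGen_of_lprod_mul_base_mul_inv`: the last letter `b` of a reduced conjugating word must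
  conjugate `φ c` back into the base group, else `l₀ (b φc b⁻¹) l₀⁻¹` is a non-empty reduced word
  with value in the base group);
* `isConj_of_base_iff` — **MKS 4.6 (i) for a letter** `g ∈ G i`: `of i g ~ base c'` iff `g` is
  conjugate *in `G i`* to some `φ i c` with `c` chained to `c'`;
* `isConj_of_of_iff`, `not_isConj_of_of`, `not_isConj_of_base` — **MKS 4.6 (ii)**: a letter
  `g ∈ G i` not conjugate within `G i` into `φ i(H)` is conjugate in the amalgam to `of i g'` iff
  `g ~_{G i} g'`, and is never conjugate to a letter of another factor or to a base element.

The cyclically-reduced-partner forms of Dyer's (1)(2), the separation of lengths `≥ 2` from lengths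
`≤ 1`, and the collapse of the chains under malnormality are in
`AmalgamConjugacyMinimalLength.lean`.

## References

* W. Magnus, A. Karrass, D. Solitar, *Combinatorial Group Theory*, Interscience (1966), §4.2,
  Thm. 4.6 (i)(ii). [MagnusKarrassSolitar1966]
* J. L. Dyer, *Separating conjugates in amalgamated free products and HNN extensions*, J. Austral.
  Math. Soc. Ser. A 29 (1980) 35–51, Thm. 2 (1)(2) p.37–38. [Dyer1980]
* R. C. Lyndon, P. E. Schupp, *Combinatorial Group Theory*, Springer (1977); Classics in
  Mathematics (2001), Ch. IV Thm. 2.6, 2.8. [LyndonSchupp2001]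
-/

namespace Literature.GroupTheory.CombinatorialGroupTheory

namespace Amalgam

open Monoid Monoid.PushoutI

variable {ι : Type*} {G : ι → Type*} [∀ i, Group (G i)] {H : Type*} [Group H]
  {φ : ∀ i, H →* G i}

/-- The value in `PushoutI φ` of a letter list. -/
local notation3 "ℓπ[" φ "] " l:max =>
  List.prod (List.map (fun x => Monoid.PushoutI.of (φ := φ) (Sigma.fst x) (Sigma.snd x)) l)

/-- The formal inverse of a letter list. -/
local notation3 "ℓinv " l:max =>
  List.reverse (List.map (fun x => Sigma.mk (Sigma.fst x) (Sigma.snd x)⁻¹) l)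

/-! ### Reduced words for conjugates of a letter -/

/-- Conjugating a letter `x ∈ G i` by the value of a word ending in the factor `G i`:
`ℓπ (l₀ b) · x · (ℓπ (l₀ b))⁻¹ = ℓπ (l₀ (b x b⁻¹) l₀⁻¹)`. [cite: MagnusKarrassSolitar1966, §4.2 Thm. 4.6] -/
theorem lprod_concat_mul_of_mul_inv (l₀ : List (Σ i, G i)) (i : ι) (b x : G i) :
    ℓπ[φ] (l₀ ++ [⟨i, b⟩]) * of i x * (ℓπ[φ] (l₀ ++ [⟨i, b⟩]))⁻¹ =
      ℓπ[φ] (l₀ ++ [⟨i, b * x * b⁻¹⟩] ++ ℓinv l₀) := by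
  rw [lprod_conj_shape]
  simp only [lprod_append, lprod_singleton, map_mul, map_inv]
  group

/-- Conjugating a letter `x ∈ G i` by the value of a word `l`:
`ℓπ l · x · (ℓπ l)⁻¹ = ℓπ (l x l⁻¹)`. [cite: MagnusKarrassSolitar1966, §4.2 Thm. 4.6] -/
theorem lprod_mul_of_mul_inv (l : List (Σ i, G i)) (i : ι) (x : G i) :
    ℓπ[φ] l * of i x * (ℓπ[φ] l)⁻¹ = ℓπ[φ] (l ++ [⟨i, x⟩] ++ ℓinv l) := by
  rw [lprod_conj_shape, lprod_singleton]

/-- If `l₀ b` alternates (`b ∈ G i`), so does `l₀ x l₀⁻¹` for any letter `x ∈ G i`.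
[cite: MagnusKarrassSolitar1966, §4.2 Thm. 4.6] -/
theorem isChain_conjWord {l₀ : List (Σ i, G i)} {i : ι} {b : G i}
    (hlc : (l₀ ++ [Sigma.mk i b]).IsChain fun a b => a.1 ≠ b.1) (x : G i) :
    (l₀ ++ [Sigma.mk i x] ++ ℓinv l₀).IsChain fun a b => a.1 ≠ b.1 := by
  have h0 : (l₀ ++ [Sigma.mk i x]).IsChain (fun a b => a.1 ≠ b.1) := isChain_concat_congr b x hlc
  refine isChain_concat_append h0
    ((isChain_inv_iff l₀).2 (hlc.infix ⟨[], [⟨i, b⟩], by simp⟩)) fun d hd => ?_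
  rw [head?_inv] at hd
  cases h1 : l₀.getLast? with
  | none => rw [h1] at hd; simp at hd
  | some e =>
    rw [h1, Option.map_some, Option.mem_some_iff] at hd
    subst hd
    exact fun h => rel_of_isChain_concat hlc e h1 h.symm

/-- If `l = l₀ b` alternates with `b ∈ G k`, `k ≠ i`, then `l x l⁻¹` alternates for any letter
`x ∈ G i`. [cite: MagnusKarrassSolitar1966, §4.2 Thm. 4.6] -/
theorem isChain_conjWord_of_ne {l₀ : List (Σ i, G i)} {k : ι} {b : G k}
    (hlc : (l₀ ++ [Sigma.mk k b]).IsChain fun a b => a.1 ≠ b.1) {i : ι} (hki : k ≠ i) (x : G i) :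
    (l₀ ++ [Sigma.mk k b] ++ [Sigma.mk i x] ++ ℓinv (l₀ ++ [Sigma.mk k b])).IsChain
      fun a b => a.1 ≠ b.1 := by
  refine isChain_concat_append (P := l₀ ++ [Sigma.mk k b]) ?_ ((isChain_inv_iff _).2 hlc)
    fun d hd => ?_
  · exact isChain_append_cons hlc (List.IsChain.singleton _) fun d hd => by
      rw [List.getLast?_concat, Option.mem_some_iff] at hd; subst hd; exact hki
  · rw [head?_inv, List.getLast?_concat, Option.map_some, Option.mem_some_iff] at hd
    subst hd
    exact fun h => hki h.symm

/-- The letters of `l x l⁻¹` avoid the base group when those of `l` do and `x` does.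
[cite: MagnusKarrassSolitar1966, §4.2 Thm. 4.6] -/
theorem offBase_conjWord {l : List (Σ i, G i)} (hlr : ∀ y ∈ l, y.2 ∉ (φ y.1).range) {i : ι}
    {x : G i} (hx : x ∉ (φ i).range) :
    ∀ y ∈ l ++ [Sigma.mk i x] ++ ℓinv l, y.2 ∉ (φ y.1).range := by
  intro y hy
  rw [List.mem_append, List.mem_append, List.mem_singleton] at hy
  rcases hy with (hy | rfl) | hy
  · exact hlr y hy
  · exact hx
  · exact (offBase_inv_iff l).2 hlr y hy

/-- A reduced word whose value is a single letter off the base group has length `1` (uniqueness of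
the syllable pattern). [cite: LyndonSchupp2001, Ch. IV Thm. 2.6] -/
theorem length_eq_one_of_lprod_eq_of (hφ : ∀ i, Function.Injective (φ i))
    {W : List (Σ i, G i)} (hWc : W.IsChain fun a b => a.1 ≠ b.1)
    (hWr : ∀ y ∈ W, y.2 ∉ (φ y.1).range) {j : ι} {x : G j} (hx : x ∉ (φ j).range)
    (h : ℓπ[φ] W = of j x) : W.length = 1 := by
  have hsr : ∀ y ∈ ([Sigma.mk j x] : List (Σ i, G i)), y.2 ∉ (φ y.1).range := by
    intro y hy; rw [List.mem_singleton] at hy; subst hy; exact hx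
  have := length_eq_of_lprod_eq hφ hWc hWr (List.IsChain.singleton _) hsr 1
    (by rw [map_one, one_mul, lprod_singleton]; exact h)
  simpa using this

/-- Two single letters off the base group with the same value lie in the same factor.
[cite: LyndonSchupp2001, Ch. IV Thm. 2.6] -/
theorem fst_eq_of_of_eq_of (hφ : ∀ i, Function.Injective (φ i)) {i j : ι} {x : G i} {y : G j}
    (hx : x ∉ (φ i).range) (h : of (φ := φ) i x = of j y) : i = j := by
  by_contra hij
  have hy : y ∉ (φ j).range := by
    rintro ⟨c, rfl⟩
    rw [of_apply_eq_base, ← of_apply_eq_base φ i] at h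
    exact hx ⟨c, (of_injective hφ i h).symm⟩
  refine lprod_cons_ne_of_ne hφ hij (a := x) (b := y) (u := []) (u' := [])
    (List.IsChain.singleton _) ?_ (List.IsChain.singleton _) ?_ 1 ?_
  · intro z hz; rw [List.mem_singleton] at hz; subst hz; exact hx
  · intro z hz; rw [List.mem_singleton] at hz; subst hz; exact hy
  · rw [map_one, one_mul, lprod_singleton, lprod_singleton]; exact h

/-! ### MKS 4.6 (i): conjugates of base elements -/

/-- The chain relation through the base group is symmetric, so its chains can be reversed.
[cite: MagnusKarrassSolitar1966, §4.2 Thm. 4.6] -/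
theorem reflTransGen_factorConj_symm {c c' : H}
    (h : Relation.ReflTransGen (fun c c' : H => ∃ i, IsConj (φ i c) (φ i c')) c c') :
    Relation.ReflTransGen (fun c c' : H => ∃ i, IsConj (φ i c) (φ i c')) c' c := by
  induction h with
  | refl => exact Relation.ReflTransGen.refl
  | tail _ hbc ih =>
    obtain ⟨i, hi⟩ := hbc
    exact Relation.ReflTransGen.head ⟨i, hi.symm⟩ ih

/-- A chain `c = h₀, h₁, …, h_t = c'` of elements of `H` with consecutive terms conjugate in a
factor makes `base c` and `base c'` conjugate in the amalgam (the easy half of MKS 4.6 (i)).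
[cite: MagnusKarrassSolitar1966, §4.2 Thm. 4.6] -/
theorem isConj_base_of_reflTransGen {c c' : H}
    (h : Relation.ReflTransGen (fun c c' : H => ∃ i, IsConj (φ i c) (φ i c')) c c') :
    IsConj (base φ c) (base φ c') := by
  induction h with
  | refl => exact IsConj.refl _
  | tail _ hbc ih =>
    obtain ⟨i, hi⟩ := hbc
    have := (of (φ := φ) i).map_isConj hi
    rw [of_apply_eq_base, of_apply_eq_base] at this
    exact ih.trans this

/-- **MKS 4.6 (i), core induction.**  If the value of a reduced word `l` conjugates `base c` to
`base c'`, then `c` and `c'` are joined by a chain of elements of `H`, consecutive terms conjugate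
in a factor: the last letter `b ∈ G k` of `l` must conjugate `φ k c` back into `φ k(H)` (else
`l₀ (b φc b⁻¹) l₀⁻¹` is a non-empty reduced word with value in the base group), and one recurses
on `l₀`. [cite: MagnusKarrassSolitar1966, §4.2 Thm. 4.6] -/
theorem reflTransGen_of_lprod_mul_base_mul_inv (hφ : ∀ i, Function.Injective (φ i)) :
    ∀ (l : List (Σ i, G i)), l.IsChain (fun a b => a.1 ≠ b.1) → (∀ y ∈ l, y.2 ∉ (φ y.1).range) →
      ∀ (c c' : H), ℓπ[φ] l * base φ c * (ℓπ[φ] l)⁻¹ = base φ c' →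
        Relation.ReflTransGen (fun c c' : H => ∃ i, IsConj (φ i c) (φ i c')) c c' := by
  intro l
  induction l using List.reverseRecOn with
  | nil =>
    intro _ _ c c' h
    have hc : c = c' := base_injective hφ (by simpa using h)
    subst hc
    exact Relation.ReflTransGen.refl
  | append_singleton l₀ kb ih =>
    intro hlc hlr c c' h
    obtain ⟨k, b⟩ := kb
    have hl₀c : l₀.IsChain (fun a b => a.1 ≠ b.1) := hlc.infix ⟨[], [⟨k, b⟩], by simp⟩
    have hl₀r : ∀ y ∈ l₀, y.2 ∉ (φ y.1).range := fun y hy => hlr y (List.mem_append_left _ hy)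
    rw [← of_apply_eq_base φ k, lprod_concat_mul_of_mul_inv] at h
    by_cases hbc : b * φ k c * b⁻¹ ∈ (φ k).range
    · obtain ⟨c₁, hc₁⟩ := hbc
      refine Relation.ReflTransGen.head ⟨k, isConj_iff.2 ⟨b, hc₁.symm⟩⟩ (ih hl₀c hl₀r c₁ c' ?_)
      rw [← h, lprod_conj_shape, lprod_singleton]
      dsimp only
      rw [← hc₁, of_apply_eq_base]
    · exfalso
      have hW := eq_nil_of_lprod_mem_range hφ (isChain_conjWord hlc _) (offBase_conjWord hl₀r hbc)
        (h ▸ ⟨c', rfl⟩)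
      simp at hW

/-- **MKS 4.6 (i) for base elements.**  `base c` and `base c'` are conjugate in the amalgam iff
there is a finite sequence `c = h₀, h₁, …, h_t = c'` of elements of `H` with consecutive terms
conjugate in a factor (Dyer: *"there is a sequence `h₁, h₂, …, h_r` of elements in `H` such that
`y ~_A h₁ ~_B h₂ ~_A ⋯ ~ h_r = x`"*). [cite: Dyer1980, Thm. 2 (1) p.37–38] -/
theorem isConj_base_iff_reflTransGen [Nonempty ι] (hφ : ∀ i, Function.Injective (φ i)) {c c' : H} :
    IsConj (base φ c) (base φ c') ↔
      Relation.ReflTransGen (fun c c' : H => ∃ i, IsConj (φ i c) (φ i c')) c c' := by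
  refine ⟨fun h => ?_, isConj_base_of_reflTransGen⟩
  obtain ⟨p, hp⟩ := isConj_iff.1 h
  obtain ⟨c₀, l, hlc, hlr, rfl⟩ := exists_reduced_eq hφ p
  have h1 : ℓπ[φ] l * base φ c * (ℓπ[φ] l)⁻¹ = base φ (c₀⁻¹ * c' * c₀) := by
    rw [map_mul, map_mul, map_inv, ← hp]; group
  have h2 := reflTransGen_of_lprod_mul_base_mul_inv hφ l hlc hlr c _ h1
  obtain ⟨i₀⟩ := ‹Nonempty ι›
  refine h2.tail ⟨i₀, isConj_iff.2 ⟨φ i₀ c₀, ?_⟩⟩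
  rw [← map_mul, ← map_inv, ← map_mul]
  congr 1
  group

/-- **MKS 4.6 (i) for a letter, core.**  If the value of a reduced word `l` conjugates the letter
`g ∈ G i` to `base c''`, then `g` is conjugate *within `G i`* to some `φ i c` with `c` chained to
`c''` through the base group. [cite: MagnusKarrassSolitar1966, §4.2 Thm. 4.6] -/
theorem exists_isConj_apply_of_lprod_mul_of_mul_inv (hφ : ∀ i, Function.Injective (φ i))
    {l : List (Σ i, G i)} (hlc : l.IsChain fun a b => a.1 ≠ b.1)
    (hlr : ∀ y ∈ l, y.2 ∉ (φ y.1).range) {i : ι} {g : G i} {c'' : H}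
    (h : ℓπ[φ] l * of i g * (ℓπ[φ] l)⁻¹ = base φ c'') :
    ∃ c : H, IsConj g (φ i c) ∧
      Relation.ReflTransGen (fun c c' : H => ∃ i, IsConj (φ i c) (φ i c')) c c'' := by
  by_cases hg : g ∈ (φ i).range
  · obtain ⟨c, rfl⟩ := hg
    rw [of_apply_eq_base] at h
    exact ⟨c, IsConj.refl _, reflTransGen_of_lprod_mul_base_mul_inv hφ l hlc hlr c c'' h⟩
  rcases List.eq_nil_or_concat l with rfl | ⟨l₀, ⟨k, b⟩, hl⟩
  · exfalso
    apply hg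
    refine ⟨c'', of_injective hφ i ?_⟩
    rw [of_apply_eq_base]
    simpa using h.symm
  rw [List.concat_eq_append] at hl
  subst hl
  have hl₀c : l₀.IsChain (fun a b => a.1 ≠ b.1) := hlc.infix ⟨[], [⟨k, b⟩], by simp⟩
  have hl₀r : ∀ y ∈ l₀, y.2 ∉ (φ y.1).range := fun y hy => hlr y (List.mem_append_left _ hy)
  by_cases hki : k = i
  · subst k
    rw [lprod_concat_mul_of_mul_inv] at h
    by_cases hbg : b * g * b⁻¹ ∈ (φ i).range
    · obtain ⟨c, hc⟩ := hbg
      refine ⟨c, isConj_iff.2 ⟨b, hc.symm⟩,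
        reflTransGen_of_lprod_mul_base_mul_inv hφ l₀ hl₀c hl₀r c c'' ?_⟩
      rw [← h, lprod_conj_shape, lprod_singleton]
      dsimp only
      rw [← hc, of_apply_eq_base]
    · exfalso
      have hW := eq_nil_of_lprod_mem_range hφ (isChain_conjWord hlc _) (offBase_conjWord hl₀r hbg)
        (h ▸ ⟨c'', rfl⟩)
      simp at hW
  · exfalso
    rw [lprod_mul_of_mul_inv] at h
    have hW := eq_nil_of_lprod_mem_range hφ (isChain_conjWord_of_ne hlc hki g)
      (offBase_conjWord hlr hg) (h ▸ ⟨c'', rfl⟩)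
    simp at hW

/-- **MKS 4.6 (i) for a letter.**  For `g ∈ G i`, `of i g` is conjugate in the amalgam to
`base c'` iff `g` is conjugate *in `G i`* to some `φ i c` and `c` is joined to `c'` by a finite
sequence of elements of `H` with consecutive terms conjugate in a factor (Dyer: *"if `y ∈ A` say,
there is a sequence `h₁, h₂, …, h_r` of elements in `H` such that `y ~_A h₁ ~_B h₂ ~_A ⋯ ~ h_r = x`"*).
[cite: Dyer1980, Thm. 2 (1) p.37–38] -/
theorem isConj_of_base_iff (hφ : ∀ i, Function.Injective (φ i)) {i : ι} {g : G i} {c' : H} :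
    IsConj (of (φ := φ) i g) (base φ c') ↔
      ∃ c : H, IsConj g (φ i c) ∧
        Relation.ReflTransGen (fun c c' : H => ∃ i, IsConj (φ i c) (φ i c')) c c' := by
  constructor
  · intro h
    obtain ⟨p, hp⟩ := isConj_iff.1 h
    obtain ⟨c₀, l, hlc, hlr, rfl⟩ := exists_reduced_eq hφ p
    have h1 : ℓπ[φ] l * of i g * (ℓπ[φ] l)⁻¹ = base φ (c₀⁻¹ * c' * c₀) := by
      rw [map_mul, map_mul, map_inv, ← hp]; group
    obtain ⟨c, hgc, hcc⟩ := exists_isConj_apply_of_lprod_mul_of_mul_inv hφ hlc hlr h1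
    refine ⟨c, hgc, hcc.tail ⟨i, isConj_iff.2 ⟨φ i c₀, ?_⟩⟩⟩
    rw [← map_mul, ← map_inv, ← map_mul]
    congr 1
    group
  · rintro ⟨c, hgc, hcc⟩
    have h1 : IsConj (of (φ := φ) i g) (base φ c) := by
      have := (of (φ := φ) i).map_isConj hgc
      rwa [of_apply_eq_base] at this
    exact h1.trans (isConj_base_of_reflTransGen hcc)

/-! ### MKS 4.6 (ii): letters not conjugate into the base group -/

/-- **MKS 4.6 (ii), core.**  Let `g ∈ G i` be not conjugate within `G i` into `φ i(H)`.  If the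
value of a reduced word `l` conjugates `of i g` to a letter `of j x`, then `of j x = of i (a g a⁻¹)`
for some `a ∈ G i`: the conjugating word has length `≤ 1` and lies in `G i`.
[cite: MagnusKarrassSolitar1966, §4.2 Thm. 4.6] -/
theorem exists_of_eq_of_conj_of_lprod_mul_of_mul_inv (hφ : ∀ i, Function.Injective (φ i))
    {i : ι} {g : G i} (hg : ∀ a : G i, a * g * a⁻¹ ∉ (φ i).range)
    {l : List (Σ i, G i)} (hlc : l.IsChain fun a b => a.1 ≠ b.1)
    (hlr : ∀ y ∈ l, y.2 ∉ (φ y.1).range) {j : ι} {x : G j}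
    (h : ℓπ[φ] l * of i g * (ℓπ[φ] l)⁻¹ = of j x) : ∃ a : G i, of (φ := φ) j x = of i (a * g * a⁻¹) := by
  have hg1 : g ∉ (φ i).range := by simpa using hg 1
  rcases List.eq_nil_or_concat l with rfl | ⟨l₀, ⟨k, b⟩, hl⟩
  · exact ⟨1, by simpa using h.symm⟩
  rw [List.concat_eq_append] at hl
  subst hl
  have hl₀r : ∀ y ∈ l₀, y.2 ∉ (φ y.1).range := fun y hy => hlr y (List.mem_append_left _ hy)
  by_cases hki : k = i
  · subst k
    rw [lprod_concat_mul_of_mul_inv] at h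
    have hWc := isChain_conjWord hlc (b * g * b⁻¹)
    have hWr := offBase_conjWord (φ := φ) hl₀r (hg b)
    by_cases hx : x ∈ (φ j).range
    · exfalso
      obtain ⟨c, rfl⟩ := hx
      rw [of_apply_eq_base] at h
      have hW := eq_nil_of_lprod_mem_range hφ hWc hWr (h ▸ ⟨c, rfl⟩)
      simp at hW
    · have hlen := length_eq_one_of_lprod_eq_of hφ hWc hWr hx h
      obtain rfl : l₀ = [] := by
        rcases l₀ with _ | ⟨d, l₁⟩
        · rfl
        · simp at hlen
      exact ⟨b, by simpa using h.symm⟩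
  · exfalso
    rw [lprod_mul_of_mul_inv] at h
    have hWc := isChain_conjWord_of_ne hlc hki g
    have hWr := offBase_conjWord (φ := φ) hlr hg1
    by_cases hx : x ∈ (φ j).range
    · obtain ⟨c, rfl⟩ := hx
      rw [of_apply_eq_base] at h
      have hW := eq_nil_of_lprod_mem_range hφ hWc hWr (h ▸ ⟨c, rfl⟩)
      simp at hW
    · have hlen := length_eq_one_of_lprod_eq_of hφ hWc hWr hx h
      simp at hlen
      omega

/-- **MKS 4.6 (ii), same factor.**  If `g ∈ G i` is not conjugate within `G i` into `φ i(H)`,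
then `of i g` and `of i g'` are conjugate in the amalgam iff `g` and `g'` are conjugate in `G i`
(Dyer: *"either `x ∈ A`, `y ∈ A` and `x ~_A y`, or else `x ∈ B`, `y ∈ B` and `x ~_B y`"*).
[cite: Dyer1980, Thm. 2 (2) p.38] -/
theorem isConj_of_of_iff (hφ : ∀ i, Function.Injective (φ i)) {i : ι} {g g' : G i}
    (hg : ∀ a : G i, a * g * a⁻¹ ∉ (φ i).range) :
    IsConj (of (φ := φ) i g) (of i g') ↔ IsConj g g' := by
  refine ⟨fun h => ?_, (of (φ := φ) i).map_isConj⟩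
  obtain ⟨p, hp⟩ := isConj_iff.1 h
  obtain ⟨c₀, l, hlc, hlr, rfl⟩ := exists_reduced_eq hφ p
  have h1 : ℓπ[φ] l * of i g * (ℓπ[φ] l)⁻¹ = of i ((φ i c₀)⁻¹ * g' * φ i c₀) := by
    rw [map_mul, map_mul, map_inv, of_apply_eq_base, ← hp]; group
  obtain ⟨a, ha⟩ := exists_of_eq_of_conj_of_lprod_mul_of_mul_inv hφ hg hlc hlr h1
  have e : (φ i c₀)⁻¹ * g' * φ i c₀ = a * g * a⁻¹ := of_injective hφ i ha
  refine isConj_iff.2 ⟨φ i c₀ * a, ?_⟩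
  calc φ i c₀ * a * g * (φ i c₀ * a)⁻¹ = φ i c₀ * (a * g * a⁻¹) * (φ i c₀)⁻¹ := by group
    _ = g' := by rw [← e]; group

/-- **MKS 4.6 (ii), different factors.**  A letter `g ∈ G i` not conjugate within `G i` into
`φ i(H)` is not conjugate in the amalgam to any letter of another factor `G j`, `j ≠ i`.
[cite: Dyer1980, Thm. 2 (2) p.38] -/
theorem not_isConj_of_of (hφ : ∀ i, Function.Injective (φ i)) {i j : ι} (hij : i ≠ j) {g : G i}
    (hg : ∀ a : G i, a * g * a⁻¹ ∉ (φ i).range) (x : G j) : ¬ IsConj (of (φ := φ) i g) (of j x) := by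
  intro h
  obtain ⟨p, hp⟩ := isConj_iff.1 h
  obtain ⟨c₀, l, hlc, hlr, rfl⟩ := exists_reduced_eq hφ p
  have h1 : ℓπ[φ] l * of i g * (ℓπ[φ] l)⁻¹ = of j ((φ j c₀)⁻¹ * x * φ j c₀) := by
    rw [map_mul, map_mul, map_inv, of_apply_eq_base, ← hp]; group
  obtain ⟨a, ha⟩ := exists_of_eq_of_conj_of_lprod_mul_of_mul_inv hφ hg hlc hlr h1
  exact hij (fst_eq_of_of_eq_of hφ (hg a) ha.symm)

/-- **MKS 4.6 (ii) vs (i).**  A letter `g ∈ G i` not conjugate within `G i` into `φ i(H)` is not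
conjugate in the amalgam to any element of the base group (it is of minimal length `1`; Dyer:
*"any cyclically reduced element of `P` is of minimal length in its conjugacy class except for
elements of length one that are conjugate to elements in `H`"*). [cite: Dyer1980, Thm. 2 (2) p.38] -/
theorem not_isConj_of_base (hφ : ∀ i, Function.Injective (φ i)) {i : ι} {g : G i}
    (hg : ∀ a : G i, a * g * a⁻¹ ∉ (φ i).range) (c : H) : ¬ IsConj (of (φ := φ) i g) (base φ c) := by
  intro h
  obtain ⟨c₁, hc₁, -⟩ := (isConj_of_base_iff hφ).1 h
  obtain ⟨a, ha⟩ := isConj_iff.1 hc₁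
  exact hg a ⟨c₁, ha.symm⟩

end Amalgam

end Literature.GroupTheory.CombinatorialGroupTheory
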